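import Mathlib
import Literature.Analysis.FluidPDE.VectorCalculus
import Literature.Analysis.FluidPDE.SpaceTimeRescaling
import Summits.NavierStokesRegularity.NavierStokesRegularity.Theses.SlicedKelvin

/-!
# Crux `SlicedKelvin.FluxZoom` (stmt-NavierStokesRegularity-15603), line `registered`,
# stub `stub_fluxVelocity`: scaling out the energy in the velocity bound at bounded planar flux

Support file (theorems only, `--supports stmt-NavierStokesRegularity-15603`) for the lead's
skeleton of the crux `FluxZoom` of route `SlicedKelvin`. The statement of the neighbouring stub
`stub_unitScaleVelocity` — the **unit-scale velocity bound**: an absolute `C_v ≥ 0` with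
`‖v(x)‖ ≤ r W + 3Φ/(π r) + C_v ‖v‖_{L²}` for every `C²` divergence-free `v ∈ L²(ℝ³)` with
`|curl v| ≤ W`, unsigned flux of `curl v` at most `Φ` through every plane, every `x` and every
`0 < r ≤ 1` — implies the **scale-invariant velocity bound**

  `‖v(x)‖² ≤ (12/π) · W · Φ`

for every such field (`W · Φ` has the dimension of a velocity squared). This is the route's
support `FluxVelocityBound` in the class where it is true and needed (`C² ∩ L²`, no decay at
infinity assumed).

## Proof (scaling out the energy)

Fix `x` and `ℓ > 0` and zoom: `v_ℓ(y) = ℓ v(x + ℓ y)`. Then `v_ℓ` is `C²`, divergence free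
(`D v_ℓ(y) = ℓ² Dv(x + ℓ y)`), `curl v_ℓ(y) = ℓ² curl v(x + ℓ y)` (so `|curl v_ℓ| ≤ ℓ² W`), the
unsigned flux of `curl v_ℓ` through the plane `R{y₂ = c}` is the flux of `curl v` through the
plane `R{y₂ = a₂ + ℓ c}`, `a = R⁻¹ x` (the factor `ℓ²` of the curl cancels the Jacobian `ℓ⁻²` of
the planar change of variables), hence `≤ Φ`, and `‖v_ℓ‖_{L²} = ℓ^{-1/2} ‖v‖_{L²}`
(`∫ |v_ℓ|² = ℓ² · ℓ⁻³ ∫ |v|²`). The unit-scale bound for `v_ℓ` at `y = 0` with `r = ρ/ℓ`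
(`ℓ ≥ ρ`) reads, after division by `ℓ`,

  `‖v(x)‖ ≤ ρ W + 3Φ/(π ρ) + C_v ‖v‖_{L²} ℓ^{-3/2}`,

and `ℓ → ∞` gives `‖v(x)‖ ≤ ρ W + 3Φ/(πρ)` for every `ρ > 0`. If `W = 0`, `ρ → ∞` forces
`v(x) = 0`; if `W > 0` and `a = ‖v(x)‖ > 0`, the choice `ρ = a/(2W)` gives
`a ≤ a/2 + 6WΦ/(πa)`, i.e. `a² ≤ 12 W Φ/π`.

No named fact is assumed: every ingredient is a theorem of Mathlib or of the tree
(`Literature.Analysis.FluidPDE.lintegral_comp_space_affine`, `SpaceTimeRescaling.lean`).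

## References

* P. G. Lemarié-Rieusset, *The Navier–Stokes Problem in the 21st Century* (2016), §11
  (scaling) [LemarieRieusset2016].
* A. J. Majda, A. L. Bertozzi, *Vorticity and Incompressible Flow* (CUP 2002), §2.4.1
  [MajdaBertozziCUP2002].
-/

noncomputable section

-- the summit and its single sub-problem share the name (CONVENTIONS §1), as in every Theorems file
set_option linter.dupNamespace false

open MeasureTheory Set Function Filter Metric Real InnerProductSpace
open _root_.Topology
open scoped ENNReal NNReal RealInnerProductSpace

namespace Summit.NavierStokesRegularity.NavierStokesRegularity.Theorems.FluxZoom.Registered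

open Literature.Analysis.FluidPDE

/-! ### The zoomed field `v_ℓ(y) = ℓ v(x + ℓ y)` -/

/-- Chain rule for the zoomed field: `D(ℓ v(x + ℓ ·))(y) = ℓ² Dv(x + ℓ y)` for differentiable
`v`. -/
private theorem fderiv_zoom {v : EuclideanSpace ℝ (Fin 3) → EuclideanSpace ℝ (Fin 3)}
    (hv : Differentiable ℝ v) (x : EuclideanSpace ℝ (Fin 3)) (ℓ : ℝ)
    (y : EuclideanSpace ℝ (Fin 3)) :
    fderiv ℝ (fun y => ℓ • v (x + ℓ • y)) y = (ℓ ^ 2) • fderiv ℝ v (x + ℓ • y) := by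
  have hg : Differentiable ℝ fun y : EuclideanSpace ℝ (Fin 3) => v (x + ℓ • y) :=
    hv.comp ((differentiable_const _).add (differentiable_id.const_smul ℓ))
  rw [fderiv_fun_const_smul (hg y)]
  have h := fderiv_comp_smul (𝕜 := ℝ) (f := fun z => v (x + z)) (x := y) ℓ
  rw [fderiv_comp_add_left] at h
  rw [h, smul_smul, pow_two]

/-- The curl of the zoomed field: `curl (ℓ v(x + ℓ ·))(y) = ℓ² curl v(x + ℓ y)`. -/
private theorem curl_zoom {v : EuclideanSpace ℝ (Fin 3) → EuclideanSpace ℝ (Fin 3)}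
    (hv : Differentiable ℝ v) (x : EuclideanSpace ℝ (Fin 3)) (ℓ : ℝ)
    (y : EuclideanSpace ℝ (Fin 3)) :
    curl (fun y => ℓ • v (x + ℓ • y)) y = (ℓ ^ 2) • curl v (x + ℓ • y) := by
  simp only [curl, fderiv_zoom hv x ℓ y, _root_.smul_apply, PiLp.smul_apply,
    smul_eq_mul]
  ext i
  fin_cases i <;> simp <;> ring

/-- The zoomed field of a divergence-free field is divergence free:
`div (ℓ v(x + ℓ ·))(y) = ℓ² div v(x + ℓ y) = 0`. -/
private theorem isDivFree_zoom {v : EuclideanSpace ℝ (Fin 3) → EuclideanSpace ℝ (Fin 3)}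
    (hv : Differentiable ℝ v) (hdiv : VectorCalculus.IsDivFree v) (x : EuclideanSpace ℝ (Fin 3))
    (ℓ : ℝ) : VectorCalculus.IsDivFree (fun y => ℓ • v (x + ℓ • y)) := by
  intro y
  have h := hdiv (x + ℓ • y)
  simp only [VectorCalculus.divergence] at h ⊢
  rw [fderiv_zoom hv x ℓ y, ContinuousLinearMap.toLinearMap_smul, map_smul, h, smul_zero]

/-- The energy of the zoomed field: `∫ |ℓ v(x + ℓ y)|² dy = ℓ² · ℓ⁻³ ∫ |v|²` (`ℓ > 0`). -/
private theorem lintegral_zoom (v : EuclideanSpace ℝ (Fin 3) → EuclideanSpace ℝ (Fin 3))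
    (x : EuclideanSpace ℝ (Fin 3)) {ℓ : ℝ} (hℓ : 0 < ℓ) :
    ∫⁻ y, ‖ℓ • v (x + ℓ • y)‖ₑ ^ 2 =
      ENNReal.ofReal (ℓ ^ 2) * ENNReal.ofReal (ℓ ^ 3)⁻¹ * ∫⁻ y, ‖v y‖ₑ ^ 2 := by
  have h1 : ∀ y, ‖ℓ • v (x + ℓ • y)‖ₑ ^ 2 = ENNReal.ofReal (ℓ ^ 2) * ‖v (x + ℓ • y)‖ₑ ^ 2 := by
    intro y
    rw [enorm_smul, mul_pow, Real.enorm_eq_ofReal hℓ.le, ← ENNReal.ofReal_pow hℓ.le]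
  simp_rw [h1]
  rw [lintegral_const_mul' _ _ ENNReal.ofReal_ne_top,
    lintegral_comp_space_affine hℓ x (fun z => ‖v z‖ₑ ^ 2), finrank_euclideanSpace_fin,
    mul_assoc]

/-- The `L²` norm as the square root of the energy: `‖f‖_{L²} = (∫ |f|²)^{1/2}`. -/
private theorem eLpNorm_two_eq (f : EuclideanSpace ℝ (Fin 3) → EuclideanSpace ℝ (Fin 3)) :
    eLpNorm f 2 volume = (∫⁻ y, ‖f y‖ₑ ^ 2) ^ (1 / 2 : ℝ) := by
  rw [eLpNorm_eq_lintegral_rpow_enorm_toReal two_ne_zero ENNReal.ofNat_ne_top, ENNReal.toReal_ofNat]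
  simp_rw [ENNReal.rpow_two]

/-- The `L²` norm of the zoomed field: `‖ℓ v(x + ℓ ·)‖_{L²} = √(ℓ⁻¹) ‖v‖_{L²}` (`ℓ > 0`,
`v ∈ L²`). -/
private theorem toReal_eLpNorm_zoom (v : EuclideanSpace ℝ (Fin 3) → EuclideanSpace ℝ (Fin 3))
    (x : EuclideanSpace ℝ (Fin 3)) {ℓ : ℝ} (hℓ : 0 < ℓ) :
    (eLpNorm (fun y => ℓ • v (x + ℓ • y)) 2 volume).toReal =
      Real.sqrt ℓ⁻¹ * (eLpNorm v 2 volume).toReal := by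
  rw [eLpNorm_two_eq, eLpNorm_two_eq, lintegral_zoom v x hℓ, ← ENNReal.toReal_rpow,
    ← ENNReal.toReal_rpow, ENNReal.toReal_mul, ENNReal.toReal_mul,
    ENNReal.toReal_ofReal (by positivity), ENNReal.toReal_ofReal (by positivity),
    Real.mul_rpow (by positivity) ENNReal.toReal_nonneg, Real.sqrt_eq_rpow]
  congr 2
  field_simp

/-- A point of the plane `R⁻¹x + ℓ · {y₂ = c}` in the coordinates of the statement: with
`a = R⁻¹ x`, `x + ℓ R(y₀, y₁, c) = R(a₀ + ℓ y₀, a₁ + ℓ y₁, a₂ + ℓ c)`. -/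
private theorem zoom_plane_point (R : EuclideanSpace ℝ (Fin 3) ≃ₗᵢ[ℝ] EuclideanSpace ℝ (Fin 3))
    (x : EuclideanSpace ℝ (Fin 3)) (ℓ c : ℝ) (y : EuclideanSpace ℝ (Fin 2)) :
    x + ℓ • R (WithLp.toLp 2 ![y 0, y 1, c]) =
      R (WithLp.toLp 2
        ![(WithLp.toLp 2 ![R.symm x 0, R.symm x 1] + ℓ • y : EuclideanSpace ℝ (Fin 2)) 0,
          (WithLp.toLp 2 ![R.symm x 0, R.symm x 1] + ℓ • y : EuclideanSpace ℝ (Fin 2)) 1,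
          R.symm x 2 + ℓ * c]) := by
  have h : (WithLp.toLp 2
        ![(WithLp.toLp 2 ![R.symm x 0, R.symm x 1] + ℓ • y : EuclideanSpace ℝ (Fin 2)) 0,
          (WithLp.toLp 2 ![R.symm x 0, R.symm x 1] + ℓ • y : EuclideanSpace ℝ (Fin 2)) 1,
          R.symm x 2 + ℓ * c] : EuclideanSpace ℝ (Fin 3)) =
      R.symm x + ℓ • WithLp.toLp 2 ![y 0, y 1, c] := by
    ext i
    fin_cases i <;> simp
  rw [h, map_add, LinearIsometryEquiv.map_smul, LinearIsometryEquiv.apply_symm_apply]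

/-! ### The stub -/

/-- **Stub `stub_fluxVelocity` of the crux `SlicedKelvin.FluxZoom`, line `registered`: scaling
out the energy.** The statement of `stub_unitScaleVelocity` (an absolute `C_v ≥ 0` with
`‖v(x)‖ ≤ rW + 3Φ/(πr) + C_v‖v‖_{L²}` for `0 < r ≤ 1`, every `C²` divergence-free `v ∈ L²(ℝ³)`
with `|curl v| ≤ W` and planar flux of `curl v` `≤ Φ`) implies the scale-invariant bound
`‖v(x)‖² ≤ (12/π)·W·Φ` for every such field: apply the unit-scale bound to the zoomed field
`v_ℓ = ℓ • v(x + ℓ •·)` at `0` with `r = ρ/ℓ` (`|curl v_ℓ| ≤ ℓ²W`, flux of `curl v_ℓ` `≤ Φ`,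
`‖v_ℓ‖₂ = ℓ^{-1/2}‖v‖₂`), so that `‖v(x)‖ ≤ ρW + 3Φ/(πρ) + C_v ℓ^{-3/2}‖v‖₂`; let `ℓ → ∞`,
then take `ρ = ‖v(x)‖/(2W)`. -/
theorem stub_fluxVelocity :
    (∃ Cv : ℝ, 0 ≤ Cv ∧
      ∀ (v : EuclideanSpace ℝ (Fin 3) → EuclideanSpace ℝ (Fin 3)), ContDiff ℝ 2 v →
        Literature.Analysis.FluidPDE.VectorCalculus.IsDivFree v →
        (∫⁻ y, ‖v y‖ₑ ^ 2 < ⊤) →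
        ∀ (W Φ : ℝ), 0 ≤ W → 0 ≤ Φ →
          (∀ x, ‖Literature.Analysis.FluidPDE.curl v x‖ ≤ W) →
          (∀ (R : EuclideanSpace ℝ (Fin 3) ≃ₗᵢ[ℝ] EuclideanSpace ℝ (Fin 3)) (c : ℝ),
            ∫⁻ y : EuclideanSpace ℝ (Fin 2),
              ‖inner ℝ (Literature.Analysis.FluidPDE.curl v (R (WithLp.toLp 2 ![y 0, y 1, c])))
                (R (EuclideanSpace.single 2 1))‖ₑ ≤ ENNReal.ofReal Φ) →
          ∀ (x : EuclideanSpace ℝ (Fin 3)) (r : ℝ), 0 < r → r ≤ 1 →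
            ‖v x‖ ≤ r * W + 3 * Φ / (Real.pi * r) +
              Cv * (MeasureTheory.eLpNorm v 2 MeasureTheory.volume).toReal) →
    ∀ (v : EuclideanSpace ℝ (Fin 3) → EuclideanSpace ℝ (Fin 3)), ContDiff ℝ 2 v →
      Literature.Analysis.FluidPDE.VectorCalculus.IsDivFree v →
      (∫⁻ y, ‖v y‖ₑ ^ 2 < ⊤) →
      ∀ (W Φ : ℝ), 0 ≤ W → 0 ≤ Φ →
        (∀ x, ‖Literature.Analysis.FluidPDE.curl v x‖ ≤ W) →
        (∀ (R : EuclideanSpace ℝ (Fin 3) ≃ₗᵢ[ℝ] EuclideanSpace ℝ (Fin 3)) (c : ℝ),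
          ∫⁻ y : EuclideanSpace ℝ (Fin 2),
            ‖inner ℝ (Literature.Analysis.FluidPDE.curl v (R (WithLp.toLp 2 ![y 0, y 1, c])))
              (R (EuclideanSpace.single 2 1))‖ₑ ≤ ENNReal.ofReal Φ) →
        ∀ x, ‖v x‖ ^ 2 ≤ 12 / Real.pi * W * Φ := by
  rintro ⟨Cv, hCv, hU⟩ v hv hdiv hv2 W Φ hW hΦ hcurl hflux x
  have hvd : Differentiable ℝ v := hv.differentiable two_ne_zero
  set N : ℝ := (eLpNorm v 2 volume).toReal with hN
  -- Step 1: the bound at every scale `ρ > 0`, the energy scaled out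
  have key : ∀ ρ : ℝ, 0 < ρ → ‖v x‖ ≤ ρ * W + 3 * Φ / (π * ρ) := by
    intro ρ hρ
    -- the unit-scale bound for the zoomed field `v_ℓ`, `ℓ ≥ ρ`
    have hℓ : ∀ ℓ : ℝ, ρ ≤ ℓ →
        ‖v x‖ ≤ ρ * W + 3 * Φ / (π * ρ) + Cv * N * (Real.sqrt ℓ⁻¹ / ℓ) := by
      intro ℓ hρℓ
      have hℓ0 : 0 < ℓ := hρ.trans_le hρℓ
      set vl : EuclideanSpace ℝ (Fin 3) → EuclideanSpace ℝ (Fin 3) :=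
        fun y => ℓ • v (x + ℓ • y) with hvl
      have h1 : ContDiff ℝ 2 vl :=
        (hv.comp (contDiff_const.add (contDiff_id.const_smul ℓ))).const_smul ℓ
      have h2 : VectorCalculus.IsDivFree vl := isDivFree_zoom hvd hdiv x ℓ
      have h3 : ∫⁻ y, ‖vl y‖ₑ ^ 2 < ⊤ := by
        rw [hvl, lintegral_zoom v x hℓ0]
        exact ENNReal.mul_lt_top (ENNReal.mul_lt_top ENNReal.ofReal_lt_top ENNReal.ofReal_lt_top)
          hv2
      have h4 : ∀ y, ‖curl vl y‖ ≤ ℓ ^ 2 * W := by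
        intro y
        rw [hvl, curl_zoom hvd x ℓ y, norm_smul, Real.norm_of_nonneg (sq_nonneg ℓ)]
        exact mul_le_mul_of_nonneg_left (hcurl _) (sq_nonneg ℓ)
      have h5 : ∀ (R : EuclideanSpace ℝ (Fin 3) ≃ₗᵢ[ℝ] EuclideanSpace ℝ (Fin 3)) (c : ℝ),
          ∫⁻ y : EuclideanSpace ℝ (Fin 2),
            ‖⟪curl vl (R (WithLp.toLp 2 ![y 0, y 1, c])), R (EuclideanSpace.single 2 1)⟫‖ₑ ≤
              ENNReal.ofReal Φ := by
        intro R c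
        -- the plane `R {y₂ = c}` of `v_ℓ` is the plane `R {y₂ = a₂ + ℓ c}` of `v`, `a = R⁻¹ x`
        set a' : EuclideanSpace ℝ (Fin 2) := WithLp.toLp 2 ![R.symm x 0, R.symm x 1] with ha'
        set c' : ℝ := R.symm x 2 + ℓ * c with hc'
        set G : EuclideanSpace ℝ (Fin 2) → ℝ≥0∞ := fun z =>
          ‖⟪curl v (R (WithLp.toLp 2 ![z 0, z 1, c'])), R (EuclideanSpace.single 2 1)⟫‖ₑ with hG
        have hpt : ∀ y : EuclideanSpace ℝ (Fin 2),
            ‖⟪curl vl (R (WithLp.toLp 2 ![y 0, y 1, c])), R (EuclideanSpace.single 2 1)⟫‖ₑ =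
              ENNReal.ofReal (ℓ ^ 2) * G (a' + ℓ • y) := by
          intro y
          rw [hvl, curl_zoom hvd x ℓ, zoom_plane_point R x ℓ c y, real_inner_smul_left, enorm_mul,
            Real.enorm_eq_ofReal (sq_nonneg ℓ)]
        rw [lintegral_congr hpt, lintegral_const_mul' _ _ ENNReal.ofReal_ne_top,
          lintegral_comp_space_affine hℓ0 a' G, finrank_euclideanSpace_fin, ← mul_assoc,
          ← ENNReal.ofReal_mul (sq_nonneg ℓ), mul_inv_cancel₀ (pow_ne_zero 2 hℓ0.ne'),
          ENNReal.ofReal_one, one_mul]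
        exact hflux R c'
      have h6 := hU vl h1 h2 h3 (ℓ ^ 2 * W) Φ (by positivity) hΦ h4 h5 0 (ρ / ℓ)
        (div_pos hρ hℓ0) ((div_le_one hℓ0).2 hρℓ)
      have h7 : vl 0 = ℓ • v x := by
        simp [hvl]
      rw [h7, toReal_eLpNorm_zoom v x hℓ0, norm_smul, Real.norm_of_nonneg hℓ0.le] at h6
      refine le_of_mul_le_mul_left (h6.trans_eq ?_) hℓ0
      field_simp
      ring
    -- `ℓ → ∞`
    have hlim : Tendsto (fun ℓ : ℝ => ρ * W + 3 * Φ / (π * ρ) + Cv * N * (Real.sqrt ℓ⁻¹ / ℓ))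
        atTop (𝓝 (ρ * W + 3 * Φ / (π * ρ) + Cv * N * 0)) :=
      tendsto_const_nhds.add
        (tendsto_const_nhds.mul (tendsto_inv_atTop_zero.sqrt.div_atTop tendsto_id))
    rw [mul_zero, add_zero] at hlim
    exact ge_of_tendsto hlim (eventually_atTop.2 ⟨ρ, hℓ⟩)
  -- Step 2: optimise in `ρ`
  rcases (norm_nonneg (v x)).eq_or_lt with ha | ha
  · rw [← ha, zero_pow two_ne_zero]
    positivity
  rcases hW.eq_or_lt with hW0 | hW0
  · -- `W = 0`: `ρ → ∞` contradicts `v x ≠ 0`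
    exfalso
    set ρ : ℝ := 3 * Φ / (π * ‖v x‖) + 1 with hρ
    have hρ0 : 0 < ρ := by positivity
    have h1 := key ρ hρ0
    rw [← hW0, mul_zero, zero_add, le_div_iff₀ (by positivity)] at h1
    have h2 : ‖v x‖ * (π * ρ) = 3 * Φ + π * ‖v x‖ := by
      rw [hρ]
      field_simp
    rw [h2] at h1
    linarith [mul_pos pi_pos ha]
  · -- `W > 0`: `ρ = ‖v x‖ / (2 W)`
    have h1 := key (‖v x‖ / (2 * W)) (by positivity)
    have h2 : ‖v x‖ / (2 * W) * W = ‖v x‖ / 2 := by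
      field_simp
    have h3 : 3 * Φ / (π * (‖v x‖ / (2 * W))) = 6 * W * Φ / (π * ‖v x‖) := by
      field_simp
      ring
    rw [h2, h3, ← sub_le_iff_le_add', le_div_iff₀ (by positivity)] at h1
    rw [show 12 / π * W * Φ = 12 * W * Φ / π by ring, le_div_iff₀ pi_pos]
    nlinarith [h1]

end Summit.NavierStokesRegularity.NavierStokesRegularity.Theorems.FluxZoom.Registered
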